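import Mathlib
import Literature.Analysis.PDE.KernelTransferCore
import HarnessLib

/-!
# Kernel transfer: the energy distance between a true kernel datum and its exact shadow

Analysis/Calculus-type support file for the far-side channel estimate (everything proved, no
definitions). Let `E_0,…,E_ℓ` be `C²` functions with `|E_j − c_jι^{ℓ−j}| ≤ K x^{j−ℓ−1/2}`,
`|(E_j − c_jι^{ℓ−j})'| ≤ K x^{j−ℓ−3/2}` on `[x₁, ∞)` (`x₁ ≥ 1`, `ι = 1/x` there,
`c_j = ∏_{k<ℓ}(j−2k−1)`), and let `0 ≤ V ≤ W₀ x⁻²` on `[x₁,∞)`. For coefficient sequences `a, b` put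
(the Cauchy data of the true kernel element `Σ_k (a_k/c_{2k}) P_{2k} + Σ_k (b_k/((2k+1)c_{2k})) P_{2k+1}`
and of its exact shadow)

  `tpos = Σ_k (a_k/c_{2k}) E_{2k} + Σ_k (b_k/((2k+1)c_{2k})) E_{2k+1}`,  `kpos = Σ_k a_k ι^{ℓ−2k}`,
  `tvel = Σ_k (a_k/c_{2k}) (2k) E_{2k−1} + Σ_k (b_k/c_{2k}) E_{2k}`,      `kvel = Σ_k b_k ι^{ℓ−2k}`

(`k < ℓ/2+1` resp. `k < (ℓ+1)/2`). Then (`kernelTransfer_energy_le`) for `ρ ≥ x₁`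

  `∫_{x>ρ} (tvel − kvel)² + ((tpos − kpos)')² + V (tpos − kpos)² ≤ (Kt/ρ) (Σ_k a_k² ρ^{4k−2ℓ−1} + Σ_k b_k² ρ^{4k−2ℓ+1})`

with `Kt` depending only on `ℓ, K, W₀`; the right-hand side is `Kt/(σρ)` times the lower frame
bound of the exact datum (`MonomialFrameBound.lean`). The proof rewrites the three differences as
sums of the six error families of `KernelTransferBounds.lean` and applies the family-form
inequality `kernelTransfer_core` (`KernelTransferCore.lean`). Route PhotonSphereChannels,
`FixedModeChannels`, far side (stmt-FinalStateConjecture-10048). Folklore.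
-/

noncomputable section

namespace Literature.Analysis.PDE

open MeasureTheory Set Filter Topology Finset

section Transfer

variable {ι V : ℝ → ℝ} {E : ℕ → ℝ → ℝ} {ℓ : ℕ} {x₁ K W₀ : ℝ}

/-- **Kernel transfer inequality.** See the module docstring; `tpos, tvel` are the Cauchy data of
`Σ_k (a_k/c_{2k}) P_{2k} + Σ_k (b_k/((2k+1)c_{2k})) P_{2k+1}` written out, `kpos, kvel` the exact
kernel datum `(Σ a_kι^{ℓ−2k}, Σ b_kι^{ℓ−2k})`. [folklore] -/
theorem kernelTransfer_energy_le (hι : ContDiff ℝ (⊤ : ℕ∞) ι)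
    (hιeq : ∀ x : ℝ, 1 / 2 ≤ x → ι x = x⁻¹) (hx₁ : 1 ≤ x₁)
    (hW₀ : 0 ≤ W₀) (hEC : ∀ j, j ≤ ℓ → ContDiff ℝ 2 (E j))
    (hEb : ∀ j, j ≤ ℓ → ∀ x, x₁ ≤ x →
      |E j x - (∏ i ∈ range ℓ, ((j : ℝ) - 2 * i - 1)) * ι x ^ (ℓ - j)| ≤ K * x ^ ((j : ℝ) - ℓ - 1 / 2) ∧
      |deriv (E j) x - deriv (fun y => (∏ i ∈ range ℓ, ((j : ℝ) - 2 * i - 1)) * ι y ^ (ℓ - j)) x|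
        ≤ K * x ^ ((j : ℝ) - ℓ - 3 / 2))
    (hV : Continuous V) (hV0 : ∀ x, 0 ≤ V x) (hVW : ∀ x, x₁ ≤ x → V x ≤ W₀ * x ^ (-(2 : ℝ))) :
    ∃ Kt : ℝ, 0 ≤ Kt ∧ ∀ (a b : ℕ → ℝ) (ρ : ℝ), x₁ ≤ ρ →
      IntegrableOn (fun z =>
        ((∑ k ∈ range (ℓ / 2 + 1), a k / (∏ i ∈ range ℓ, (((2 * k : ℕ) : ℝ) - 2 * i - 1))
              * ((2 * k : ℕ) : ℝ) * E (2 * k - 1) z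
          + ∑ k ∈ range ((ℓ + 1) / 2), b k / (((2 * k + 1 : ℕ) : ℝ)
              * ∏ i ∈ range ℓ, (((2 * k : ℕ) : ℝ) - 2 * i - 1)) * (((2 * k + 1 : ℕ) : ℝ) * E (2 * k) z))
          - ∑ k ∈ range ((ℓ + 1) / 2), b k * ι z ^ (ℓ - 2 * k)) ^ 2
        + deriv (fun y =>
          (∑ k ∈ range (ℓ / 2 + 1), a k / (∏ i ∈ range ℓ, (((2 * k : ℕ) : ℝ) - 2 * i - 1)) * E (2 * k) y
          + ∑ k ∈ range ((ℓ + 1) / 2), b k / (((2 * k + 1 : ℕ) : ℝ)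
              * ∏ i ∈ range ℓ, (((2 * k : ℕ) : ℝ) - 2 * i - 1)) * E (2 * k + 1) y)
          - ∑ k ∈ range (ℓ / 2 + 1), a k * ι y ^ (ℓ - 2 * k)) z ^ 2
        + V z * ((∑ k ∈ range (ℓ / 2 + 1), a k / (∏ i ∈ range ℓ, (((2 * k : ℕ) : ℝ) - 2 * i - 1)) * E (2 * k) z
          + ∑ k ∈ range ((ℓ + 1) / 2), b k / (((2 * k + 1 : ℕ) : ℝ)
              * ∏ i ∈ range ℓ, (((2 * k : ℕ) : ℝ) - 2 * i - 1)) * E (2 * k + 1) z)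
          - ∑ k ∈ range (ℓ / 2 + 1), a k * ι z ^ (ℓ - 2 * k)) ^ 2) (Ioi ρ) ∧
      ∫ z in Ioi ρ,
        (((∑ k ∈ range (ℓ / 2 + 1), a k / (∏ i ∈ range ℓ, (((2 * k : ℕ) : ℝ) - 2 * i - 1))
              * ((2 * k : ℕ) : ℝ) * E (2 * k - 1) z
          + ∑ k ∈ range ((ℓ + 1) / 2), b k / (((2 * k + 1 : ℕ) : ℝ)
              * ∏ i ∈ range ℓ, (((2 * k : ℕ) : ℝ) - 2 * i - 1)) * (((2 * k + 1 : ℕ) : ℝ) * E (2 * k) z))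
          - ∑ k ∈ range ((ℓ + 1) / 2), b k * ι z ^ (ℓ - 2 * k)) ^ 2
        + deriv (fun y =>
          (∑ k ∈ range (ℓ / 2 + 1), a k / (∏ i ∈ range ℓ, (((2 * k : ℕ) : ℝ) - 2 * i - 1)) * E (2 * k) y
          + ∑ k ∈ range ((ℓ + 1) / 2), b k / (((2 * k + 1 : ℕ) : ℝ)
              * ∏ i ∈ range ℓ, (((2 * k : ℕ) : ℝ) - 2 * i - 1)) * E (2 * k + 1) y)
          - ∑ k ∈ range (ℓ / 2 + 1), a k * ι y ^ (ℓ - 2 * k)) z ^ 2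
        + V z * ((∑ k ∈ range (ℓ / 2 + 1), a k / (∏ i ∈ range ℓ, (((2 * k : ℕ) : ℝ) - 2 * i - 1)) * E (2 * k) z
          + ∑ k ∈ range ((ℓ + 1) / 2), b k / (((2 * k + 1 : ℕ) : ℝ)
              * ∏ i ∈ range ℓ, (((2 * k : ℕ) : ℝ) - 2 * i - 1)) * E (2 * k + 1) z)
          - ∑ k ∈ range (ℓ / 2 + 1), a k * ι z ^ (ℓ - 2 * k)) ^ 2)
      ≤ Kt / ρ * (∑ k ∈ range (ℓ / 2 + 1), a k ^ 2 * ρ ^ (4 * (k : ℝ) - 2 * ℓ - 1)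
          + ∑ k ∈ range ((ℓ + 1) / 2), b k ^ 2 * ρ ^ (4 * (k : ℝ) - 2 * ℓ + 1)) := by
  obtain ⟨Kt, hKt, H⟩ := kernelTransfer_core hι hιeq hx₁ hW₀ hEC hEb hV hV0 hVW
  refine ⟨Kt, hKt, fun a b ρ hρ => ?_⟩
  -- the families
  set cE : ℕ → ℝ := fun k => ∏ i ∈ range ℓ, (((2 * k : ℕ) : ℝ) - 2 * i - 1) with hcE
  set uVA : ℕ → ℝ → ℝ := fun k z => a k / cE k * ((2 * k : ℕ) : ℝ) * E (2 * k - 1) z with huVA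
  set uVB : ℕ → ℝ → ℝ := fun k z => b k / cE k * (E (2 * k) z - cE k * ι z ^ (ℓ - 2 * k)) with huVB
  set uPA : ℕ → ℝ → ℝ := fun k z => a k / cE k * (E (2 * k) z - cE k * ι z ^ (ℓ - 2 * k)) with huPA
  set uPB : ℕ → ℝ → ℝ := fun k z => b k / (((2 * k + 1 : ℕ) : ℝ) * cE k) * E (2 * k + 1) z
    with huPB
  set dPA : ℕ → ℝ → ℝ := fun k z => a k / cE k *
    (deriv (E (2 * k)) z - deriv (fun y => cE k * ι y ^ (ℓ - 2 * k)) z) with hdPA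
  set dPB : ℕ → ℝ → ℝ := fun k z =>
    b k / (((2 * k + 1 : ℕ) : ℝ) * cE k) * deriv (E (2 * k + 1)) z with hdPB
  -- regularity
  have hka : ∀ k, k ∈ range (ℓ / 2 + 1) → 2 * k ≤ ℓ := fun k hk => by
    have := mem_range.1 hk; omega
  have hkb : ∀ k, k ∈ range ((ℓ + 1) / 2) → 2 * k + 1 ≤ ℓ := fun k hk => by
    have := mem_range.1 hk; omega
  have hEd : ∀ j, j ≤ ℓ → Differentiable ℝ (E j) := fun j hj =>
    (hEC j hj).differentiable (by norm_num)
  have hιnd : ∀ (cc : ℝ) (n : ℕ), Differentiable ℝ fun y => cc * ι y ^ n := fun cc n =>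
    ((hι.differentiable (by simp)).pow n).const_mul cc
  -- identities with the statement's expressions
  have hvel : ∀ z, (∑ k ∈ range (ℓ / 2 + 1), a k / (∏ i ∈ range ℓ, (((2 * k : ℕ) : ℝ) - 2 * i - 1))
              * ((2 * k : ℕ) : ℝ) * E (2 * k - 1) z
          + ∑ k ∈ range ((ℓ + 1) / 2), b k / (((2 * k + 1 : ℕ) : ℝ)
              * ∏ i ∈ range ℓ, (((2 * k : ℕ) : ℝ) - 2 * i - 1)) * (((2 * k + 1 : ℕ) : ℝ) * E (2 * k) z))
          - ∑ k ∈ range ((ℓ + 1) / 2), b k * ι z ^ (ℓ - 2 * k)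
        = ∑ k ∈ range (ℓ / 2 + 1), uVA k z + ∑ k ∈ range ((ℓ + 1) / 2), uVB k z := by
    intro z
    rw [add_sub_assoc, ← Finset.sum_sub_distrib]
    refine congrArg₂ (· + ·) (sum_congr rfl fun k _ => ?_) (sum_congr rfl fun k _ => ?_)
    · simp only [huVA, hcE]
    · simp only [huVB, hcE]
      have hc : (∏ i ∈ range ℓ, (((2 * k : ℕ) : ℝ) - 2 * i - 1)) ≠ 0 := towerCoeff_even_ne_zero ℓ k
      have h21 : (((2 * k + 1 : ℕ)) : ℝ) ≠ 0 := by positivity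
      field_simp
  have hposf : (fun y => (∑ k ∈ range (ℓ / 2 + 1),
            a k / (∏ i ∈ range ℓ, (((2 * k : ℕ) : ℝ) - 2 * i - 1)) * E (2 * k) y
          + ∑ k ∈ range ((ℓ + 1) / 2), b k / (((2 * k + 1 : ℕ) : ℝ)
              * ∏ i ∈ range ℓ, (((2 * k : ℕ) : ℝ) - 2 * i - 1)) * E (2 * k + 1) y)
          - ∑ k ∈ range (ℓ / 2 + 1), a k * ι y ^ (ℓ - 2 * k))
        = fun y => ∑ k ∈ range (ℓ / 2 + 1), uPA k y + ∑ k ∈ range ((ℓ + 1) / 2), uPB k y := by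
    funext y
    rw [add_sub_right_comm, ← Finset.sum_sub_distrib]
    refine congrArg₂ (· + ·) (sum_congr rfl fun k _ => ?_) (sum_congr rfl fun k _ => ?_)
    · simp only [huPA, hcE]
      have hc : (∏ i ∈ range ℓ, (((2 * k : ℕ) : ℝ) - 2 * i - 1)) ≠ 0 := towerCoeff_even_ne_zero ℓ k
      field_simp
    · simp only [huPB, hcE]
  have hpos : ∀ y, (∑ k ∈ range (ℓ / 2 + 1),
            a k / (∏ i ∈ range ℓ, (((2 * k : ℕ) : ℝ) - 2 * i - 1)) * E (2 * k) y
          + ∑ k ∈ range ((ℓ + 1) / 2), b k / (((2 * k + 1 : ℕ) : ℝ)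
              * ∏ i ∈ range ℓ, (((2 * k : ℕ) : ℝ) - 2 * i - 1)) * E (2 * k + 1) y)
          - ∑ k ∈ range (ℓ / 2 + 1), a k * ι y ^ (ℓ - 2 * k)
        = ∑ k ∈ range (ℓ / 2 + 1), uPA k y + ∑ k ∈ range ((ℓ + 1) / 2), uPB k y :=
    fun y => congrFun hposf y
  have hdA : ∀ k ∈ range (ℓ / 2 + 1), ∀ z, HasDerivAt (fun y => uPA k y) (dPA k z) z := by
    intro k hk z
    exact (((hEd (2 * k) (hka k hk)).differentiableAt (x := z)).hasDerivAt.sub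
      ((hιnd (cE k) (ℓ - 2 * k)).differentiableAt (x := z)).hasDerivAt).const_mul (a k / cE k)
  have hdB : ∀ k ∈ range ((ℓ + 1) / 2), ∀ z, HasDerivAt (fun y => uPB k y) (dPB k z) z := by
    intro k hk z
    exact ((hEd (2 * k + 1) (hkb k hk)).differentiableAt (x := z)).hasDerivAt.const_mul
      (b k / (((2 * k + 1 : ℕ) : ℝ) * cE k))
  have hder : ∀ z, deriv (fun y => (∑ k ∈ range (ℓ / 2 + 1),
            a k / (∏ i ∈ range ℓ, (((2 * k : ℕ) : ℝ) - 2 * i - 1)) * E (2 * k) y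
          + ∑ k ∈ range ((ℓ + 1) / 2), b k / (((2 * k + 1 : ℕ) : ℝ)
              * ∏ i ∈ range ℓ, (((2 * k : ℕ) : ℝ) - 2 * i - 1)) * E (2 * k + 1) y)
          - ∑ k ∈ range (ℓ / 2 + 1), a k * ι y ^ (ℓ - 2 * k)) z
        = ∑ k ∈ range (ℓ / 2 + 1), dPA k z + ∑ k ∈ range ((ℓ + 1) / 2), dPB k z := by
    intro z
    rw [hposf]
    exact ((HasDerivAt.fun_sum fun k hk => hdA k hk z).add
      (HasDerivAt.fun_sum fun k hk => hdB k hk z)).deriv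
  have hfun : (fun z =>
        ((∑ k ∈ range (ℓ / 2 + 1), a k / (∏ i ∈ range ℓ, (((2 * k : ℕ) : ℝ) - 2 * i - 1))
              * ((2 * k : ℕ) : ℝ) * E (2 * k - 1) z
          + ∑ k ∈ range ((ℓ + 1) / 2), b k / (((2 * k + 1 : ℕ) : ℝ)
              * ∏ i ∈ range ℓ, (((2 * k : ℕ) : ℝ) - 2 * i - 1)) * (((2 * k + 1 : ℕ) : ℝ) * E (2 * k) z))
          - ∑ k ∈ range ((ℓ + 1) / 2), b k * ι z ^ (ℓ - 2 * k)) ^ 2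
        + deriv (fun y =>
          (∑ k ∈ range (ℓ / 2 + 1), a k / (∏ i ∈ range ℓ, (((2 * k : ℕ) : ℝ) - 2 * i - 1)) * E (2 * k) y
          + ∑ k ∈ range ((ℓ + 1) / 2), b k / (((2 * k + 1 : ℕ) : ℝ)
              * ∏ i ∈ range ℓ, (((2 * k : ℕ) : ℝ) - 2 * i - 1)) * E (2 * k + 1) y)
          - ∑ k ∈ range (ℓ / 2 + 1), a k * ι y ^ (ℓ - 2 * k)) z ^ 2
        + V z * ((∑ k ∈ range (ℓ / 2 + 1),
            a k / (∏ i ∈ range ℓ, (((2 * k : ℕ) : ℝ) - 2 * i - 1)) * E (2 * k) z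
          + ∑ k ∈ range ((ℓ + 1) / 2), b k / (((2 * k + 1 : ℕ) : ℝ)
              * ∏ i ∈ range ℓ, (((2 * k : ℕ) : ℝ) - 2 * i - 1)) * E (2 * k + 1) z)
          - ∑ k ∈ range (ℓ / 2 + 1), a k * ι z ^ (ℓ - 2 * k)) ^ 2)
      = fun z => (∑ k ∈ range (ℓ / 2 + 1), uVA k z + ∑ k ∈ range ((ℓ + 1) / 2), uVB k z) ^ 2
          + (∑ k ∈ range (ℓ / 2 + 1), dPA k z + ∑ k ∈ range ((ℓ + 1) / 2), dPB k z) ^ 2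
          + V z * (∑ k ∈ range (ℓ / 2 + 1), uPA k z + ∑ k ∈ range ((ℓ + 1) / 2), uPB k z) ^ 2 := by
    funext z
    rw [hvel z, hder z, hpos z]
  rw [hfun]
  exact H a b ρ hρ cE (fun k => by rw [hcE]) uVA uVB uPA uPB dPA dPB (fun k z => by rw [huVA])
    (fun k z => by rw [huVB]) (fun k z => by rw [huPA]) (fun k z => by rw [huPB])
    (fun k z => by rw [hdPA]) (fun k z => by rw [hdPB])

end Transfer

end Literature.Analysis.PDE
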